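import Summits.QuantumFields.BalabanUV.T4Continuum.Spine.NE1p.DressedRebornMuResponse
import Summits.QuantumFields.BalabanUV.T4Continuum.Spine.NE1p.DressedRebornMuPartBipencilWitness
import Summits.QuantumFields.BalabanUV.T4Continuum.Spine.NE1p.DressedSourceAnalyticWitness

/-!
# T⁴ programme, spine estimate NE1′ (node O3b/H2) — WITNESS «THE RESPONSE AT THE CORES»: S61 §3's bi-pencil response END
# `rebornMuDeriv_locE_le_of_coresAt_bipencil_mass` APPLIED ONCE BY NAME on W86's datum (W35's letter-budget core read along the
# BI-PENCIL `0 + μ • liveTable + s • (¼ • liveTable)`, source radius `½`, room `3∕2`) on the strict source WINDOW `‖μ‖ ≤ μ₀ < ½`;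
# the response CANNOT DIE on the quarter window — any uniform bound on it PAYS for W86's live mixed difference (mean value
# inequality) — and integrating S61's bound back to the μ-part costs EXACTLY the window quotient `μ₁∕(μ₁ − μ₀)` over S56's direct bound

Cell `pub-balaban`, sub-cell `t4`, BINDER-OWNERS row NE1′; NE1′ formalisation crew, unit `b2b-balaban-t4-ne1p-formalise-leaf-06`
(LEAF PROVER 06, generation 14); crew row W101 ∕ DAG N29zzzzzp of `t4/formal/NE1p/LEAVES.md` (BOOKED typer R-T154 `HOME/CLAIMS.log`
l.25118 on INTENT l.25026; cross-read X246;
own-lineage follower of W92 `DressedRebornMuResponseWitness` (p243723) = S61 §2's exp-linear applier — this is S61 §3's applier AT THE CORES,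
as leaf-03's W86 `DressedRebornMuPartBipencilWitness` (p242645) is S56 §3's next to this unit's W84 = S56 §2's).  ADDITIVE — imports S61
`Spine/NE1p/DressedRebornMuResponse` (p243273), W86 `Spine/NE1p/DressedRebornMuPartBipencilWitness` (p242645) and W51
`Spine/NE1p/DressedSourceAnalyticWitness` (p232342; for the holomorphy of W35's activity in the source, `analyticEnd_fires`) ONLY;
THEOREMS ONLY (0 def, 0 `def … : Prop`, 0 cite); every toy datum is W86 ∕ W35 ∕ W33 ∕ W24's BY NAME (`hH_bi`, `hM3_bi`, `hact_bi`,
`norm_quarter_liveTable_pos`∕`_lt`, `coreFam`, `cM`, `actM`, `ctr0`, `hroom0`, `termsW`, `X₀`, `liveTable`, `Acst`, `hrate_torus`,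
`hsmall_mu`, `reborn_live`, `rebornEnd_fires_closed`); nothing restated.  SEAM: leaf-03's booked S64 `DressedRebornMuPartTorus` (N29zzzzzg)
is the TORUS FACE of S56 §2∕§3 + S61 §2∕§3 (an S-row, datum abstract); this file is a DECIDED applier of S61 §3 on ONE datum — disjoint.

WHY THIS FILE.  S61 typed the RESPONSE of the dressed regeneration constant — `‖∂_μ (E(μ,1) − E(μ,0))‖ ≤ 2·((2M∕ε)·‖v‖)∕(μ₁ − μ₀)` on the
window — in three faces; §2 (exp-linear tables) has this unit's decided applier W92, §3 (cores along the bi-pencil) had NONE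
(`grep -ln rebornMuDeriv_locE_le_of_coresAt_bipencil_mass Spine/NE1p/*.lean` = its own file).  W86 discharged every binder of S56 §3 on the
bi-pencil datum; S61 §3's binders are S56 §3's PLUS the window, so the END fires on W86's plumbing verbatim.  What is GENUINE here is the
converse bookkeeping between the two faces: (i) the response cannot vanish identically where W86's second difference is live, quantitatively —
`4·‖Δ(¼)‖ ≤ sup_{‖m‖ ≤ ¼} ‖∂_m G‖` for `G(m) = E(m,1) − E(m,0)`; (ii) the Cauchy route S61 → mean value → μ-part reproduces S56's bound
times `μ₁∕(μ₁ − μ₀) = (1 − 2μ₀)⁻¹ ≥ 1`, with equality only on the degenerate window `μ₀ = 0` — the response face never BEATS the direct face,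
and at the quarter window it pays exactly `2`.
* §1 `responseEnd_fires` (kernel; S61 §3 EXACTLY ONCE BY NAME at `μ₁ := ½`, `ε := 3∕2`, `u := liveTable`, `v := ¼ • liveTable`, NE5's toy
  letters `(1, 0, 1)` INLINE as in W86; window `μ₀ < ½`, `‖μ‖ ≤ μ₀`): `‖∂_m (E[actM(m + ¼)](X₀) − E[actM m](X₀))|_μ‖ ≤
  2·(2M∕(3∕2)·‖¼ • liveTable‖)∕(½ − μ₀)`; `responseEnd_fires_closed`: `≤ (16∕3)·K₀(64,8)·‖¼ • liveTable‖∕(1 − 2μ₀)`.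
* §2 GENUINE — [folklore] `norm_mixedDiff_le_of_deriv_le` (Mathlib `Convex.norm_image_sub_le_of_norm_deriv_le` on the closed source disc,
  stated for a mixed difference), `differentiableAt_shift_sub`, `norm_shift_lt_two`; `differentiableAt_rebornPart` (W51 `analyticEnd_fires` at
  radius `2` BY NAME, shifted by `¼`); `norm_rebornPart_le_of_response_le`: a uniform response bound `C` on `‖m‖ ≤ μ₀ < 7∕4` gives W86's mixed
  difference `≤ C·‖μ‖`; `four_mul_norm_mixedDiff_le_of_response_le` (`μ₀ = μ = ¼`); `response_not_identically_zero` (`C = 0` would kill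
  W86's `reborn_live`); `responseEnd_live`: `∃ ‖m‖ ≤ ¼` with the derivative bounded in §1 NON-ZERO and `≤ (16∕3)·K₀(64,8)·‖¼ • liveTable‖∕(1 − 2·¼)`.
* §3 THE PRICE OF THE RESPONSE ROUTE — `norm_mixedDiff_le_integrated` (§1 ∘ §2: `‖Δ(μ)‖ ≤ (16∕3)·K₀·‖v‖∕(1 − 2μ₀)·‖μ‖`);
  `integrated_eq_quotient_mul_direct` (`= (½∕(½ − μ₀)) × ` S56 ∕ W86's `(16∕3)·K₀·‖μ‖·‖v‖`); `one_le_quotient_iff` (`↔ 0 ≤ μ₀`),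
  `one_lt_quotient_iff` (`↔ 0 < μ₀`), `direct_lt_integrated_iff` (for a live datum the direct bound is STRICTLY below the integrated one
  `↔ 0 < μ₀`), `quotient_quarter` (`= 2`); closing `example`: at `μ₀ = μ = ¼`, `Δ(¼) ≠ 0`, integrated `≤ (8∕3)·K₀·‖v‖`, direct `≤ (4∕3)·K₀·‖v‖`.

HONEST FRAMING.  A decided toy on pv22's periodic carrier; W86 ∕ W51 ∕ W35 ∕ W33 ∕ W24's objects BY NAME; [folklore] kernel steps only (the
one-variable mean value inequality on a convex set, shifts of a holomorphic function); `(16∕3)·K₀·‖v‖∕(1 − 2μ₀)` is a READING of the response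
of the dressed (w5) constant along the bi-pencil — (B1a) exercised at a TOY core, (w5) ∕ (w6) NOT discharged on Bałaban's densities; the
«third radius» quotient `(μ₁ − μ₀)⁻¹` (t4-ref2 C-t4r2-340 (n2)) is DISPLAYED, its price against the direct face LOCATED on our two bound
SHAPES — a statement about OUR bounds, not about print; nothing of Bałaban's (2.14) data ∕ densities ∕ minimisers ∕ backgrounds instantiated
(0 binders instantiated on Bałaban's densities); (B1b) ∕ (B3) ∕ (B5) untouched ((B3) = G-ne9p2-5 UNPRINTED, shared with NE9); no wall item; the
NE1′ wall wording of record v1.8 (T4-DAG v48) — words, not kind — does NOT move; R-t4r2-Q2 NOT met; ABSOLUTE RULE honoured (no numeral of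
print; nothing internally minted is cited).  NE1′ ⇐ the named binders — NOT proved, NOT printed; spine PROVED 0∕9; count 9 unchanged.  Rung
(B)+1 on ONE finite four-torus — NOT infinite volume, NOT a mass gap, NOT OS on ℝ⁴, NOT Clay.  HONEST DEPENDENCY: continuum YM on T⁴ ⇐
BetaPertH ∧ nine spine estimates (0/9 proved); BetaPertH ⇐ (D1) ∧ (D4) ∧ CAP+tail; G-an2-4 gates asym, D1 and NE2/3/4.
-/

noncomputable section

namespace Summit.QuantumFields.BalabanUV.T4Continuum.NE1p.DressedRebornMuResponseBipencilWitness

open Set Metric MeasureTheory Complex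
open scoped BigOperators
open Literature.MathematicalPhysics.QuantumFieldTheory.Balaban1983to89
open Literature.MathematicalPhysics.QuantumFieldTheory.Balaban1983to89.B12TreeDecay (K₀ K₀_pos)
open Literature.MathematicalPhysics.QuantumFieldTheory.Balaban1983to89.B13Resummation (locE)
open Literature.MathematicalPhysics.QuantumFieldTheory.Balaban1983to89.TreeLengthTorus (TDom tsys)
open Literature.MathematicalPhysics.QuantumFieldTheory.Balaban1983to89.TreeLengthTorusGeometry (tgeometry)
open Summit.QuantumFields.BalabanUV.T4Continuum.B13HistMeasurable (B13HistM)
open Summit.QuantumFields.BalabanUV.T4Continuum.B13HistWitness (toyFrame)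
open Summit.QuantumFields.BalabanUV.T4Continuum.NE1p.DressedSmallFieldTorusWitness (X₀ hrate_torus)
open Summit.QuantumFields.BalabanUV.T4Continuum.NE1p.DressedSmallFieldGeometry (torus_consts)
open Summit.QuantumFields.BalabanUV.T4Continuum.NE1p.DressedSmallFieldGeometryFaces (K₀_four)
open Summit.QuantumFields.BalabanUV.T4Continuum.NE1p.DressedSmallFieldCoresWitness (liveTable coreFam ctr0 hroom0 Acst Acst_pos termsW)
open Summit.QuantumFields.BalabanUV.T4Continuum.NE1p.DressedSmallFieldCoresMassWitness (cM actM hsmall_mu)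
open Summit.QuantumFields.BalabanUV.T4Continuum.NE1p.DressedRebornMuPartBipencilWitness (norm_quarter_liveTable_pos
  norm_quarter_liveTable_lt hH_bi hM3_bi hact_bi rebornEnd_fires_closed reborn_live)
open Summit.QuantumFields.BalabanUV.T4Continuum.NE1p.DressedSourceAnalyticWitness (analyticEnd_fires)
open Summit.QuantumFields.BalabanUV.T4Continuum.NE1p.DressedRebornMuResponse (rebornMuDeriv_locE_le_of_coresAt_bipencil_mass)

variable (N : ℕ) [NeZero N] (r : ℝ) (hr : 0 ≤ r)

/-! ## §1 S61's RESPONSE END FIRES at the cores along W86's bi-pencil `0 + μ • liveTable + s • (¼ • liveTable)` -/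

open Classical in
/-- **S61 §3 `rebornMuDeriv_locE_le_of_coresAt_bipencil_mass` FIRES ON THE LIVE CORE** [decided toy]: W33's core family at W35's weight
`cM`, NE5's toy letters `(mq, bq, N₀) = (1, 0, 1)` INLINE in the literal binder shapes, W33's `hroom0`∕`ctr0`, W86's `hH_bi` ∕ `hM3_bi` ∕
`hact_bi` ∕ `norm_quarter_liveTable_pos` ∕ `_lt`, W24's `hrate_torus`, W35's `hsmall_mu` — S56 §3's argument list in W86 VERBATIM — PLUS the
WINDOW `μ₀ < ½`, `‖μ‖ ≤ μ₀`.  Conclusion LITERAL: the source derivative at `μ` of `m ↦ E[actM(m + 1·¼)](X₀) − E[actM(m + 0·¼)](X₀)` is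
`≤ 2·(2·M∕(3∕2)·‖¼ • liveTable‖)∕(½ − μ₀)`, `M = e·ν·c₁·K₀²·A·e⁰`. [folklore] -/
theorem responseEnd_fires (hr0 : 0 < r) (k : ℕ) {μ₀ : ℝ} (h01 : μ₀ < 1 / 2) {μ : ℂ} (hμ : ‖μ‖ ≤ μ₀) :
    ‖deriv (fun m : ℂ =>
        locE (tgeometry 4 N).ι (tgeometry 4 N).cubes (actM N r hr k (m + 1 * (1 / 4 : ℂ))) ((tgeometry 4 N).cubes (X₀ N)) -
          locE (tgeometry 4 N).ι (tgeometry 4 N).cubes (actM N r hr k (m + 0 * (1 / 4 : ℂ))) ((tgeometry 4 N).cubes (X₀ N))) μ‖ ≤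
      2 * (2 * (Real.exp 1 * (tgeometry 4 N).ν * (tgeometry 4 N).c₁ * (tgeometry 4 N).K₀ ^ 2 * Acst *
        Real.exp (-(0 * (tsys 4 N).dj (X₀ N)))) / (3 / 2) * ‖((1 / 4 : ℂ)) • (liveTable : B13HistM toyFrame)‖) / (1 / 2 - μ₀) :=
  rebornMuDeriv_locE_le_of_coresAt_bipencil_mass (tsys 4 N) (tgeometry 4 N) (coreFam (cM r) r hr)
    (W := Set.univ) (ctr := ctr0) (ROp := fun _ => 1) (RHist := fun _ => 2) (R' := fun _ => 2)
    (mq := fun _ _ _ => 1) (bq := fun _ _ _ => 0) (N₀ := fun _ _ _ => 1)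
    hroom0 (fun _ _ _ _ _ _ _ => one_pos)
    (fun _ _ _ _ _ _ _ => ⟨fun _ _ => aestronglyMeasurable_const, fun _ => differentiableOn_const _, fun _ _ _ => by
      show ‖(1 : ℂ)‖ ≤ 1; rw [norm_one]⟩)
    (fun _ _ _ _ _ _ _ => ⟨fun _ _ => (Complex.measurable_ofReal.comp (measurable_snd.norm.pow_const 2)).aestronglyMeasurable,
      fun _ _ => differentiableOn_const _, fun _ _ _ v => by
        show 1 * ‖v‖ ^ 2 - 0 ≤ (((‖v‖ ^ 2 : ℝ) : ℂ)).re; rw [Complex.ofReal_re]; simp⟩)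
    (g := fun _ => 0) (Set.mem_univ _) (U := ()) (o := 0) (h₀ := 0) (u := liveTable) (v := (1 / 4 : ℂ) • liveTable) (μ₁ := 1 / 2)
    (ε := 3 / 2) (norm_quarter_liveTable_pos r hr0) (norm_quarter_liveTable_lt)
    (by show ‖(0 : ℂ) - 0‖ ≤ 1; simp) (hH_bi k)
    (emb := fun _ => k) (fun _ => rfl) (terms := termsW N) (act := fun z => actM N r hr k (z.1 + z.2 * (1 / 4 : ℂ))) (hact_bi N r hr k)
    (A := Acst) (R := 2 * (tgeometry 4 N).κ₀ + 2) (r₁ := 0) (b₅ := 0) (X₀ := X₀ N)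
    Acst_pos.le le_rfl (by norm_num) (hrate_torus N) (hsmall_mu N) (hM3_bi N r hr k _) h01 hμ

open Classical in
/-- … in CLOSED FORM: `≤ (16∕3)·K₀(64,8)·‖¼ • liveTable‖∕(1 − 2μ₀)` (pv22's constants BY NAME; `e·ν·c₁·K₀²·A = K₀(64,8)`) — S61's per-unit
response `4M∕(ε(μ₁ − μ₀))` read at `ε = 3∕2`, `μ₁ = ½`. [folklore] -/
theorem responseEnd_fires_closed (hr0 : 0 < r) (k : ℕ) {μ₀ : ℝ} (h01 : μ₀ < 1 / 2) {μ : ℂ} (hμ : ‖μ‖ ≤ μ₀) :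
    ‖deriv (fun m : ℂ =>
        locE (tgeometry 4 N).ι (tgeometry 4 N).cubes (actM N r hr k (m + 1 * (1 / 4 : ℂ))) ((tgeometry 4 N).cubes (X₀ N)) -
          locE (tgeometry 4 N).ι (tgeometry 4 N).cubes (actM N r hr k (m + 0 * (1 / 4 : ℂ))) ((tgeometry 4 N).cubes (X₀ N))) μ‖ ≤
      16 / 3 * K₀ 64 8 * ‖((1 / 4 : ℂ)) • (liveTable : B13HistM toyFrame)‖ / (1 - 2 * μ₀) := by
  refine (responseEnd_fires N r hr hr0 k h01 hμ).trans (le_of_eq ?_)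
  rw [(torus_consts N).1, (torus_consts N).2.2, K₀_four, zero_mul, neg_zero, Real.exp_zero, mul_one]
  unfold Acst
  have hK := K₀_pos (64 : ℝ) 8
  have he := Real.exp_pos 1
  have h1 : (1 : ℝ) / 2 - μ₀ ≠ 0 := by intro h; linarith
  have h2 : (1 : ℝ) - 2 * μ₀ ≠ 0 := by intro h; linarith
  field_simp
  ring

/-! ## §2 GENUINE — ANY UNIFORM BOUND ON THE RESPONSE PAYS FOR THE RE-BORN μ-PART (mean value inequality) -/

/-- [folklore] **THE MEAN VALUE INEQUALITY FOR A MIXED DIFFERENCE**: for `A, B : ℂ → ℂ` with `m ↦ A m − B m` complex differentiable at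
every source `‖m‖ ≤ μ₀` and `‖∂_m (A − B)‖ ≤ C` there, the mixed difference over `{0, μ} × {A, B}` is `≤ C·‖μ‖` for `‖μ‖ ≤ μ₀`
(Mathlib `Convex.norm_image_sub_le_of_norm_deriv_le` on the convex closed disc). -/
theorem norm_mixedDiff_le_of_deriv_le {A B : ℂ → ℂ} {μ₀ C : ℝ} (hd : ∀ m : ℂ, ‖m‖ ≤ μ₀ → DifferentiableAt ℂ (fun m => A m - B m) m)
    (hC : ∀ m : ℂ, ‖m‖ ≤ μ₀ → ‖deriv (fun m => A m - B m) m‖ ≤ C) {μ : ℂ} (hμ : ‖μ‖ ≤ μ₀) :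
    ‖A μ - A 0 - (B μ - B 0)‖ ≤ C * ‖μ‖ := by
  have hμ0 : 0 ≤ μ₀ := (norm_nonneg μ).trans hμ
  have h := (convex_closedBall (0 : ℂ) μ₀).norm_image_sub_le_of_norm_deriv_le
    (fun x hx => hd x (mem_closedBall_zero_iff.1 hx)) (fun x hx => hC x (mem_closedBall_zero_iff.1 hx))
    (mem_closedBall_self hμ0) (mem_closedBall_zero_iff.2 hμ)
  rw [sub_zero] at h
  calc ‖A μ - A 0 - (B μ - B 0)‖ = ‖A μ - B μ - (A 0 - B 0)‖ := by congr 1; ring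
    _ ≤ C * ‖μ‖ := h

/-- [folklore] Shifted sections of a function holomorphic on a disc: if `f` is complex differentiable on `‖t‖ < R` and both shifted points
`m + a`, `m + b` lie in that disc, `m ↦ f(m + a) − f(m + b)` is differentiable at `m`. -/
theorem differentiableAt_shift_sub {f : ℂ → ℂ} {R : ℝ} (hf : DifferentiableOn ℂ f (ball (0 : ℂ) R)) {m a b : ℂ}
    (ha : ‖m + a‖ < R) (hb : ‖m + b‖ < R) : DifferentiableAt ℂ (fun m => f (m + a) - f (m + b)) m :=
  (differentiableAt_comp_add_const.2 (hf.differentiableAt (isOpen_ball.mem_nhds (mem_ball_zero_iff.2 ha)))).sub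
    (differentiableAt_comp_add_const.2 (hf.differentiableAt (isOpen_ball.mem_nhds (mem_ball_zero_iff.2 hb))))

/-- A shifted source `m + s·¼` with `‖m‖ < 7∕4`, `‖s‖ ≤ 1` stays in W35's source disc `‖t‖ < 2`. [folklore] -/
theorem norm_shift_lt_two {m s : ℂ} (hm : ‖m‖ < 7 / 4) (hs : ‖s‖ ≤ 1) : ‖m + s * (1 / 4 : ℂ)‖ < 2 := by
  have h1 : ‖s * (1 / 4 : ℂ)‖ ≤ 1 / 4 := by
    rw [norm_mul]
    have h : ‖(1 / 4 : ℂ)‖ = 1 / 4 := by norm_num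
    rw [h]
    nlinarith [norm_nonneg s]
  calc ‖m + s * (1 / 4 : ℂ)‖ ≤ ‖m‖ + ‖s * (1 / 4 : ℂ)‖ := norm_add_le _ _
    _ < 7 / 4 + 1 / 4 := by linarith
    _ = 2 := by norm_num

open Classical in
/-- **THE RE-BORN PART IS HOLOMORPHIC IN THE SOURCE** [decided toy]: `m ↦ E[actM (m + ¼)](X₀) − E[actM m](X₀)` is complex
differentiable at every `‖m‖ < 7∕4` — W51's `analyticEnd_fires` (S33 §3's source-analyticity END on W35's activity, radius `2`) BY NAME,
shifted. [folklore] -/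
theorem differentiableAt_rebornPart (k : ℕ) {m : ℂ} (hm : ‖m‖ < 7 / 4) :
    DifferentiableAt ℂ (fun m : ℂ =>
        locE (tgeometry 4 N).ι (tgeometry 4 N).cubes (actM N r hr k (m + 1 * (1 / 4 : ℂ))) ((tgeometry 4 N).cubes (X₀ N)) -
          locE (tgeometry 4 N).ι (tgeometry 4 N).cubes (actM N r hr k (m + 0 * (1 / 4 : ℂ))) ((tgeometry 4 N).cubes (X₀ N))) m :=
  differentiableAt_shift_sub (f := fun t => locE (tgeometry 4 N).ι (tgeometry 4 N).cubes (actM N r hr k t) ((tgeometry 4 N).cubes (X₀ N)))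
    (analyticEnd_fires N r hr (μ₁ := 2) le_rfl k).1 (norm_shift_lt_two hm (by norm_num)) (norm_shift_lt_two hm (by norm_num))

open Classical in
/-- **ANY UNIFORM BOUND ON THE RESPONSE OVER A SOURCE WINDOW PAYS FOR THE RE-BORN μ-PART** [decided toy]: if
`‖∂_m (E[actM(m + ¼)](X₀) − E[actM m](X₀))‖ ≤ C` at every `‖m‖ ≤ μ₀` (`μ₀ < 7∕4`), then W86's mixed difference over `{0, μ} × {0, 1}` is
`≤ C·‖μ‖` for `‖μ‖ ≤ μ₀` — the mean value inequality on the closed source disc. [folklore] -/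
theorem norm_rebornPart_le_of_response_le (k : ℕ) {μ₀ C : ℝ} (hμ₀ : μ₀ < 7 / 4)
    (hC : ∀ m : ℂ, ‖m‖ ≤ μ₀ → ‖deriv (fun m : ℂ =>
        locE (tgeometry 4 N).ι (tgeometry 4 N).cubes (actM N r hr k (m + 1 * (1 / 4 : ℂ))) ((tgeometry 4 N).cubes (X₀ N)) -
          locE (tgeometry 4 N).ι (tgeometry 4 N).cubes (actM N r hr k (m + 0 * (1 / 4 : ℂ))) ((tgeometry 4 N).cubes (X₀ N))) m‖ ≤ C)
    {μ : ℂ} (hμ : ‖μ‖ ≤ μ₀) :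
    ‖locE (tgeometry 4 N).ι (tgeometry 4 N).cubes (actM N r hr k (μ + 1 * (1 / 4 : ℂ))) ((tgeometry 4 N).cubes (X₀ N)) -
        locE (tgeometry 4 N).ι (tgeometry 4 N).cubes (actM N r hr k (0 + 1 * (1 / 4 : ℂ))) ((tgeometry 4 N).cubes (X₀ N)) -
        (locE (tgeometry 4 N).ι (tgeometry 4 N).cubes (actM N r hr k (μ + 0 * (1 / 4 : ℂ))) ((tgeometry 4 N).cubes (X₀ N)) -
          locE (tgeometry 4 N).ι (tgeometry 4 N).cubes (actM N r hr k (0 + 0 * (1 / 4 : ℂ))) ((tgeometry 4 N).cubes (X₀ N)))‖ ≤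
      C * ‖μ‖ :=
  norm_mixedDiff_le_of_deriv_le
    (A := fun m : ℂ => locE (tgeometry 4 N).ι (tgeometry 4 N).cubes (actM N r hr k (m + 1 * (1 / 4 : ℂ))) ((tgeometry 4 N).cubes (X₀ N)))
    (B := fun m : ℂ => locE (tgeometry 4 N).ι (tgeometry 4 N).cubes (actM N r hr k (m + 0 * (1 / 4 : ℂ))) ((tgeometry 4 N).cubes (X₀ N)))
    (fun _ hm => differentiableAt_rebornPart N r hr k (lt_of_le_of_lt hm hμ₀)) hC hμ

open Classical in
/-- **… AT THE QUARTER WINDOW**: a uniform response bound `C` on `‖m‖ ≤ ¼` gives `4·‖Δ(¼)‖ ≤ C` for W86's mixed difference `Δ(¼)` at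
source step `μ = ¼`. [folklore] -/
theorem four_mul_norm_mixedDiff_le_of_response_le (k : ℕ) {C : ℝ}
    (hC : ∀ m : ℂ, ‖m‖ ≤ 1 / 4 → ‖deriv (fun m : ℂ =>
        locE (tgeometry 4 N).ι (tgeometry 4 N).cubes (actM N r hr k (m + 1 * (1 / 4 : ℂ))) ((tgeometry 4 N).cubes (X₀ N)) -
          locE (tgeometry 4 N).ι (tgeometry 4 N).cubes (actM N r hr k (m + 0 * (1 / 4 : ℂ))) ((tgeometry 4 N).cubes (X₀ N))) m‖ ≤ C) :
    4 * ‖locE (tgeometry 4 N).ι (tgeometry 4 N).cubes (actM N r hr k ((1 / 4 : ℂ) + 1 * (1 / 4 : ℂ))) ((tgeometry 4 N).cubes (X₀ N)) -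
        locE (tgeometry 4 N).ι (tgeometry 4 N).cubes (actM N r hr k (0 + 1 * (1 / 4 : ℂ))) ((tgeometry 4 N).cubes (X₀ N)) -
        (locE (tgeometry 4 N).ι (tgeometry 4 N).cubes (actM N r hr k ((1 / 4 : ℂ) + 0 * (1 / 4 : ℂ))) ((tgeometry 4 N).cubes (X₀ N)) -
          locE (tgeometry 4 N).ι (tgeometry 4 N).cubes (actM N r hr k (0 + 0 * (1 / 4 : ℂ))) ((tgeometry 4 N).cubes (X₀ N)))‖ ≤ C := by
  have h := norm_rebornPart_le_of_response_le N r hr k (μ₀ := 1 / 4) (by norm_num) hC (μ := (1 / 4 : ℂ)) (by norm_num)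
  have hq : ‖(1 / 4 : ℂ)‖ = 1 / 4 := by norm_num
  rw [hq] at h
  linarith

open Classical in
/-- **THE RESPONSE OF THE RE-BORN PART DOES NOT VANISH IDENTICALLY ON THE QUARTER WINDOW** [decided toy]: were
`∂_m (E[actM(m + ¼)](X₀) − E[actM m](X₀)) = 0` at every `‖m‖ ≤ ¼`, the mean value inequality with `C = 0` would kill W86's mixed
difference at `μ = ¼` — which is NOT zero (W86 `reborn_live`: Cauchy–Schwarz against the Gaussian weight).  No closed-form derivative is
claimed. [folklore] -/
theorem response_not_identically_zero (hr0 : 0 < r) (k : ℕ) :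
    ¬ ∀ m : ℂ, ‖m‖ ≤ 1 / 4 → deriv (fun m : ℂ =>
        locE (tgeometry 4 N).ι (tgeometry 4 N).cubes (actM N r hr k (m + 1 * (1 / 4 : ℂ))) ((tgeometry 4 N).cubes (X₀ N)) -
          locE (tgeometry 4 N).ι (tgeometry 4 N).cubes (actM N r hr k (m + 0 * (1 / 4 : ℂ))) ((tgeometry 4 N).cubes (X₀ N))) m = 0 := by
  intro hzero
  have h := four_mul_norm_mixedDiff_le_of_response_le N r hr k (C := 0) fun m hm => by rw [hzero m hm, norm_zero]
  refine reborn_live N r hr hr0 k (norm_le_zero_iff.1 ?_)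
  linarith

open Classical in
/-- **S61's RESPONSE END IS INHABITED NON-VACUOUSLY AT THE CORES** [decided toy]: there is a source `‖m‖ ≤ ¼` at which the derivative
bounded by `responseEnd_fires_closed` (window `μ₀ = ¼`: `≤ (16∕3)·K₀(64,8)·‖¼ • liveTable‖∕(1 − 2·¼)`) is NOT zero. [folklore] -/
theorem responseEnd_live (hr0 : 0 < r) (k : ℕ) :
    ∃ m : ℂ, ‖m‖ ≤ 1 / 4 ∧
      deriv (fun m : ℂ =>
        locE (tgeometry 4 N).ι (tgeometry 4 N).cubes (actM N r hr k (m + 1 * (1 / 4 : ℂ))) ((tgeometry 4 N).cubes (X₀ N)) -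
          locE (tgeometry 4 N).ι (tgeometry 4 N).cubes (actM N r hr k (m + 0 * (1 / 4 : ℂ))) ((tgeometry 4 N).cubes (X₀ N))) m ≠ 0 ∧
      ‖deriv (fun m : ℂ =>
        locE (tgeometry 4 N).ι (tgeometry 4 N).cubes (actM N r hr k (m + 1 * (1 / 4 : ℂ))) ((tgeometry 4 N).cubes (X₀ N)) -
          locE (tgeometry 4 N).ι (tgeometry 4 N).cubes (actM N r hr k (m + 0 * (1 / 4 : ℂ))) ((tgeometry 4 N).cubes (X₀ N))) m‖ ≤
        16 / 3 * K₀ 64 8 * ‖((1 / 4 : ℂ)) • (liveTable : B13HistM toyFrame)‖ / (1 - 2 * (1 / 4)) := by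
  by_contra h
  refine response_not_identically_zero N r hr hr0 k fun m hm => ?_
  by_contra hne
  exact h ⟨m, hm, hne, responseEnd_fires_closed N r hr hr0 k (μ₀ := 1 / 4) (by norm_num) hm⟩

/-! ## §3 THE PRICE OF THE RESPONSE ROUTE — integrating S61's bound back to the μ-part costs exactly the window quotient `μ₁∕(μ₁ − μ₀)` -/

open Classical in
/-- **THE INTEGRATED RESPONSE BOUND** [decided toy]: for `‖μ‖ ≤ μ₀ < ½`, W86's mixed difference over `{0, μ} × {0, 1}` is
`≤ ((16∕3)·K₀(64,8)·‖¼ • liveTable‖∕(1 − 2μ₀))·‖μ‖` — §1's uniform response bound on the closed window integrated by §2's mean value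
inequality; compare S56 §3 ∕ W86 `rebornEnd_fires_closed`: `(16∕3)·K₀(64,8)·‖μ‖·‖¼ • liveTable‖` WITHOUT the quotient. [folklore] -/
theorem norm_mixedDiff_le_integrated (hr0 : 0 < r) (k : ℕ) {μ₀ : ℝ} (h01 : μ₀ < 1 / 2) {μ : ℂ} (hμ : ‖μ‖ ≤ μ₀) :
    ‖locE (tgeometry 4 N).ι (tgeometry 4 N).cubes (actM N r hr k (μ + 1 * (1 / 4 : ℂ))) ((tgeometry 4 N).cubes (X₀ N)) -
        locE (tgeometry 4 N).ι (tgeometry 4 N).cubes (actM N r hr k (0 + 1 * (1 / 4 : ℂ))) ((tgeometry 4 N).cubes (X₀ N)) -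
        (locE (tgeometry 4 N).ι (tgeometry 4 N).cubes (actM N r hr k (μ + 0 * (1 / 4 : ℂ))) ((tgeometry 4 N).cubes (X₀ N)) -
          locE (tgeometry 4 N).ι (tgeometry 4 N).cubes (actM N r hr k (0 + 0 * (1 / 4 : ℂ))) ((tgeometry 4 N).cubes (X₀ N)))‖ ≤
      16 / 3 * K₀ 64 8 * ‖((1 / 4 : ℂ)) • (liveTable : B13HistM toyFrame)‖ / (1 - 2 * μ₀) * ‖μ‖ :=
  norm_rebornPart_le_of_response_le N r hr k (by linarith) (fun _ hm => responseEnd_fires_closed N r hr hr0 k h01 hm) hμ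

/-- [folklore] **THE TWO ROUTES DIFFER BY THE WINDOW QUOTIENT**: `(16∕3)·K·V∕(1 − 2μ₀)·M = (½∕(½ − μ₀))·((16∕3)·K·M·V)` — the integrated
bound IS `μ₁∕(μ₁ − μ₀)` times the direct bound (`μ₁ = ½`; pure algebra on the two SHAPES, `μ₀ < ½`). -/
theorem integrated_eq_quotient_mul_direct {μ₀ : ℝ} (h01 : μ₀ < 1 / 2) (K V M : ℝ) :
    16 / 3 * K * V / (1 - 2 * μ₀) * M = (1 / 2) / (1 / 2 - μ₀) * (16 / 3 * K * M * V) := by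
  have h1 : (1 : ℝ) / 2 - μ₀ ≠ 0 := by intro h; linarith
  have h2 : (1 : ℝ) - 2 * μ₀ ≠ 0 := by intro h; linarith
  field_simp

/-- [folklore] The window quotient `½∕(½ − μ₀)` is `≥ 1` iff `0 ≤ μ₀`: the response route never beats the direct route. -/
theorem one_le_quotient_iff {μ₀ : ℝ} (h01 : μ₀ < 1 / 2) : 1 ≤ (1 / 2 : ℝ) / (1 / 2 - μ₀) ↔ 0 ≤ μ₀ := by
  have hpos : 0 < (1 : ℝ) / 2 - μ₀ := by linarith
  rw [le_div_iff₀ hpos]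
  constructor <;> intro h <;> linarith

/-- [folklore] … and `> 1` iff `0 < μ₀`: it ties only on the degenerate window. -/
theorem one_lt_quotient_iff {μ₀ : ℝ} (h01 : μ₀ < 1 / 2) : 1 < (1 / 2 : ℝ) / (1 / 2 - μ₀) ↔ 0 < μ₀ := by
  have hpos : 0 < (1 : ℝ) / 2 - μ₀ := by linarith
  rw [lt_div_iff₀ hpos]
  constructor <;> intro h <;> linarith

/-- [folklore] **FOR A LIVE DATUM THE DIRECT BOUND IS STRICTLY BELOW THE INTEGRATED ONE IFF THE WINDOW IS GENUINE**: with `K, V, M > 0`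
(`K₀(64,8)`, a live content `‖v‖`, a live source step `‖μ‖`), `(16∕3)·K·M·V < (16∕3)·K·V∕(1 − 2μ₀)·M ↔ 0 < μ₀`. -/
theorem direct_lt_integrated_iff {μ₀ K V M : ℝ} (h01 : μ₀ < 1 / 2) (hK : 0 < K) (hV : 0 < V) (hM : 0 < M) :
    16 / 3 * K * M * V < 16 / 3 * K * V / (1 - 2 * μ₀) * M ↔ 0 < μ₀ := by
  rw [integrated_eq_quotient_mul_direct h01]
  have hD : 0 < 16 / 3 * K * M * V := by positivity
  rw [lt_mul_iff_one_lt_left hD]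
  exact one_lt_quotient_iff h01

/-- [located] At the quarter window `μ₀ = ¼` the price of the response route is exactly `2`. -/
theorem quotient_quarter : (1 / 2 : ℝ) / (1 / 2 - 1 / 4) = 2 := by norm_num

open Classical in
/-- **THE TWO FACES SIDE BY SIDE ON THE LIVE DATUM** [located]: at `μ₀ = μ = ¼`, W86's mixed difference is NOT zero (`reborn_live`), the
integrated response bound reads `(8∕3)·K₀(64,8)·‖¼ • liveTable‖` (§3 at the quarter window: quotient `2`) and S56's direct bound
`(4∕3)·K₀(64,8)·‖¼ • liveTable‖` (W86 `rebornEnd_fires_closed`) — the factor `2` of `quotient_quarter`, decided. -/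
example (hr0 : 0 < r) (k : ℕ) :
    locE (tgeometry 4 N).ι (tgeometry 4 N).cubes (actM N r hr k ((1 / 4 : ℂ) + 1 * (1 / 4 : ℂ))) ((tgeometry 4 N).cubes (X₀ N)) -
        locE (tgeometry 4 N).ι (tgeometry 4 N).cubes (actM N r hr k (0 + 1 * (1 / 4 : ℂ))) ((tgeometry 4 N).cubes (X₀ N)) -
        (locE (tgeometry 4 N).ι (tgeometry 4 N).cubes (actM N r hr k ((1 / 4 : ℂ) + 0 * (1 / 4 : ℂ))) ((tgeometry 4 N).cubes (X₀ N)) -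
          locE (tgeometry 4 N).ι (tgeometry 4 N).cubes (actM N r hr k (0 + 0 * (1 / 4 : ℂ))) ((tgeometry 4 N).cubes (X₀ N))) ≠ 0 ∧
    ‖locE (tgeometry 4 N).ι (tgeometry 4 N).cubes (actM N r hr k ((1 / 4 : ℂ) + 1 * (1 / 4 : ℂ))) ((tgeometry 4 N).cubes (X₀ N)) -
        locE (tgeometry 4 N).ι (tgeometry 4 N).cubes (actM N r hr k (0 + 1 * (1 / 4 : ℂ))) ((tgeometry 4 N).cubes (X₀ N)) -
        (locE (tgeometry 4 N).ι (tgeometry 4 N).cubes (actM N r hr k ((1 / 4 : ℂ) + 0 * (1 / 4 : ℂ))) ((tgeometry 4 N).cubes (X₀ N)) -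
          locE (tgeometry 4 N).ι (tgeometry 4 N).cubes (actM N r hr k (0 + 0 * (1 / 4 : ℂ))) ((tgeometry 4 N).cubes (X₀ N)))‖ ≤
      8 / 3 * K₀ 64 8 * ‖((1 / 4 : ℂ)) • (liveTable : B13HistM toyFrame)‖ ∧
    ‖locE (tgeometry 4 N).ι (tgeometry 4 N).cubes (actM N r hr k ((1 / 4 : ℂ) + 1 * (1 / 4 : ℂ))) ((tgeometry 4 N).cubes (X₀ N)) -
        locE (tgeometry 4 N).ι (tgeometry 4 N).cubes (actM N r hr k (0 + 1 * (1 / 4 : ℂ))) ((tgeometry 4 N).cubes (X₀ N)) -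
        (locE (tgeometry 4 N).ι (tgeometry 4 N).cubes (actM N r hr k ((1 / 4 : ℂ) + 0 * (1 / 4 : ℂ))) ((tgeometry 4 N).cubes (X₀ N)) -
          locE (tgeometry 4 N).ι (tgeometry 4 N).cubes (actM N r hr k (0 + 0 * (1 / 4 : ℂ))) ((tgeometry 4 N).cubes (X₀ N)))‖ ≤
      4 / 3 * K₀ 64 8 * ‖((1 / 4 : ℂ)) • (liveTable : B13HistM toyFrame)‖ := by
  refine ⟨reborn_live N r hr hr0 k, ?_, ?_⟩
  · have h := norm_mixedDiff_le_integrated N r hr hr0 k (μ₀ := 1 / 4) (by norm_num) (μ := (1 / 4 : ℂ)) (by norm_num)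
    have hq : ‖(1 / 4 : ℂ)‖ = 1 / 4 := by norm_num
    rw [hq] at h
    refine h.trans (le_of_eq ?_)
    ring
  · have h := rebornEnd_fires_closed N r hr hr0 k (μ := (1 / 4 : ℂ)) (mem_ball_zero_iff.2 (by norm_num))
    have hq : ‖(1 / 4 : ℂ)‖ = 1 / 4 := by norm_num
    rw [hq] at h
    refine h.trans (le_of_eq ?_)
    ring

end Summit.QuantumFields.BalabanUV.T4Continuum.NE1p.DressedRebornMuResponseBipencilWitness

end
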